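import Literature.NumberTheory.EllipticCurves.KrizLi2019.TwoPartBSDTwists
import Literature.NumberTheory.EllipticCurves.Zhai2021.TwoAdicLowerBoundTwists
import HarnessLib

/-!
# Kriz–Li 2019 (FMS 7, e15), §6 Table 1 («Assumption (★) for rank one curves») — the rows `91a1` and `91b1` AS PRINTED: for the optimal curves
# `E ∈ {91a1, 91b1}` with `K = ℚ(√−55)`, Assumption (★) holds (statement-only named facts; the per-curve inputs of Thm 5.1 (2) = `thm112_bsdTwo_twist`
# at the two rank-one rows of the table whose Heegner field has COMPOSITE discriminant `d_K = −55`; both curves GOOD at `2` with `c₂(E) = 1`)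

HONEST FRAMING (cell `bsd-f1-sign2`, seat `bsd-line-gk2-p2` g35, crux U₂ `MinimalTwinBSDTwo` stmt-BirchSwinnertonDyer-22985, LINE 23 «twin_swap»;
2026-08-31): two PUBLISHED per-curve computational assertions (check-marks in a table of a refereed paper) vendored as named `Prop`s — nothing asserted,
nothing discharged (D-0014) — with a locator into the held source; companions of `KrizLi2019.table1_row37a1/43a1/101a1/…/219b1` (this seat's lineage,
g34) in the SAME shape (optimal parametrisation datum transcribed because Example 6.2 searches «rank one OPTIMAL elliptic curves»; both curves are GOOD
at `2`, so consumers of Thm 5.1 (2) may ignore the optimality conjunct).  These two rows complete the transcription of ALL 22 non-CM rank-one rows of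
Table 1 with a check-mark and `c₂(E)` odd (the 23rd, `243a1`, is CM: `Table1Row243a1.lean`).  For both rows the companion `E^{(−55)}` has conductor
`55²·91 = 275275 > 5000`, outside Creutz–Miller's range: the consumer (`Summits/…/Theorems/GenusKolyvaginAtTwoMinimalTwinBSDTwoKrizLiAnchor91a1/91b1.lean`,
this seat) takes the companion's `BSD(2)` from the rank-zero WALL (all four rows, or — both curves having `a₁ = 0`, i.e. supersingular at `2` — the
supersingular row 19097 alone) and only the base's from Creutz–Miller (`N = 91 < 5000`).  Everything else about the rows (`E(ℚ)[2] = 0`, a point of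
infinite order, the Heegner hypothesis `(−55/7) = (−55/13) = 1`, `c₂ = 1`, `N = 91`) is decided IN THE KERNEL by the consumer; `K` is universally
quantified (no `ℚ(√−55)` is constructed).  Nothing is booked here; BSD is not proved by any of this.

Source. D. Kriz, C. Li, *Goldfeld's conjecture and congruences between Heegner points*, Forum Math. Sigma **7** (2019), e15, doi:10.1017/fms.2019.9
[KrizLi2019] = arXiv:1606.03172 (§§1–6). Texts read: the held chunk text `paper:doi-10-1017-fms-2019-9` (p0017 L21: Example 6.2), which DROPS the table
body; the table itself was read in the arXiv v3 source `Congruence.tex` (copy at `run/shared/lean/pub/bsd-print-cf2/lit/krizli2019/arXiv-1606.03172v3-Congruence.tex`),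
ll. 964–1017 (`\label{tab:1}`, Example 6.2), rows at lines 974 (`91a1 & -55 & 1 & \checkmark`) and 975 (`91b1 & -55 & 1 & \checkmark`).

## The printed statement (verbatim)

* Example 6.2 (tex l. 965): "We search for rank one optimal elliptic curves with `E(ℚ)[2] = 0` satisfying these two necessary conditions. There are 38
  such curves of conductor `≤ 300`. For each curve, we choose `K` with smallest `|d_K|` satisfying the Heegner hypothesis for `N` and such that `2` is
  split in `K`. Then 31 out of 38 curves satisfy (★). See Table 1. The first three columns list `E`, `d_K` and the local Tamagawa number `c₂(E)` at `2`
  respectively. A check-mark in the last column means that (★) holds … If `c₂(E)` is further odd (true for 23 out of 31), then the application to BSD(2)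
  (Theorem 5.1) also applies."
* Table 1, caption "Assumption (★) for rank one curves", header `E | d_K | c₂(E) | ★`, rows: "`37a1 & -7 & 1 & ✓`", "`43a1 & -7 & 1 & ✓`", "`88a1 & -7 & 4 & ✓`",
  "**`91a1 & -55 & 1 & ✓`**", "**`91b1 & -55 & 1 & ✓`**", "`92b1 & -7 & 3 & ✓`", "`101a1 & -23 & 1 & ✓`", ….

## Transcription (tree dictionary of `KrizLi2019/TwoPartBSDTwists.lean`)

`E = 91a1` = Cremona's globally minimal model `y² + y = x³ + x` = `[0, 0, 1, 1, 0]` (`Δ = −91`, `N = 91 = 7·13`); `E = 91b1` = `y² + y = x³ + x² − 7x + 5` =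
`[0, 1, 1, −7, 5]` (`Δ = −91`, `N = 91`) — the models of the tree's kit census `HypothesisSweep/RecordsN000011to000115.lean` (rows `91a1`, `91b1`).
"`K = ℚ(√d_K)`" = any `K` with `IsImaginaryQuadratic K` and `NumberField.discr K = −55`.  "Optimal curve with its parametrisation" = a datum
`Dt : ModularParametrizationData E N` at the conductor level (`NeZero` witness packed) with `Zhai2021.IsOptimalDatum E Dt`; "(★) holds" = a Heegner datum `H`,
an embedding `ι`, a point `P ∈ E(K)` mapping to `heegnerPointComplex Dt H`, and `j : K →ₐ[ℚ] ℚ₂` with `AssumptionStar E Dt K P j`.  Global minimality of the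
printed model is a binder `[IsGloballyMinimal]`.  "Rank one", "`E(ℚ)[2] = 0`", "`c₂(E) = 1`" are NOT transcribed (kernel-side in the consumer).  Nothing
weaker or stronger is transcribed; no `_holds` is expected.  Status: PUB (refereed); per-curve computational TABLE entries, flag word for the referee: TABLE.

## References
* [KrizLi2019] §6 Example 6.2 and Table 1 (rows 91a1, 91b1) (FMS chunk p0017 L21; arXiv:1606.03172v3 `Congruence.tex` ll. 965, 974, 975); Assumption (★)
  (arXiv p0003 L45–L48); Thm 5.1 (2) = arXiv Thm 1.12.
* [CremonaAlgorithms1997] Table 1 (curves 91A1 = `[0,0,1,1,0]`, 91B1 = `[0,1,1,−7,5]`; `r = 1`).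
* [Zhai2021BSDExactFormulaTwists] §1 (the optimality predicate `IsOptimalDatum`).
-/

noncomputable section

open scoped Classical

open NumberField WeierstrassCurve Literature.NumberTheory.EllipticCurves
  Literature.NumberTheory.EllipticCurves.ModularForms

namespace Literature.NumberTheory.EllipticCurves.KrizLi2019

/-- **Kriz–Li 2019, §6 Table 1, row `91a1`** (verbatim in the module docstring: `91a1 | d_K = −55 | c₂(E) = 1 | ★ ✓`; Example 6.2): for every imaginary
quadratic field `K` of discriminant `−55`, the optimal curve `91a1` on its (globally minimal) model `[0,0,1,1,0]` (`y² + y = x³ + x`) admits an OPTIMAL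
modular parametrisation datum `Dt` at level `N(E)`, a Heegner datum `H` of discriminant `d_K` and level `N(E)`, an embedding `ι : K → ℂ`, a point `P ∈ E(K)`
mapping to `heegnerPointComplex Dt H`, and `j : K → ℚ₂` with `AssumptionStar E Dt K P j`.  Statement only; TABLE entry; no `_holds` expected.
[cite: KrizLi2019, §6 Table 1 (row 91a1) and Example 6.2 (FMS 7 (2019) e15, chunk p0017 L21; arXiv:1606.03172v3 Congruence.tex ll. 965, 974)] -/
def table1_row91a1 : Prop :=
  ∀ [(⟨0, 0, 1, 1, 0⟩ : WeierstrassCurve ℚ).IsGloballyMinimal]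
    (K : Type) [Field K] [NumberField K], IsImaginaryQuadratic K → NumberField.discr K = -55 →
    ∃ (_ : NeZero ((⟨0, 0, 1, 1, 0⟩ : WeierstrassCurve ℚ).conductorNorm ℤ))
      (Dt : ModularParametrizationData (⟨0, 0, 1, 1, 0⟩ : WeierstrassCurve ℚ) ((⟨0, 0, 1, 1, 0⟩ : WeierstrassCurve ℚ).conductorNorm ℤ))
      (H : HeegnerDatum ((⟨0, 0, 1, 1, 0⟩ : WeierstrassCurve ℚ).conductorNorm ℤ) (NumberField.discr K))
      (ι : K →+* ℂ) (P : ((⟨0, 0, 1, 1, 0⟩ : WeierstrassCurve ℚ).baseChange K).toAffine.Point) (j : K →ₐ[ℚ] ℚ_[2]),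
      Zhai2021.IsOptimalDatum (⟨0, 0, 1, 1, 0⟩ : WeierstrassCurve ℚ) Dt ∧
        WeierstrassCurve.Affine.Point.map ι.toRatAlgHom P = heegnerPointComplex Dt H ∧
          AssumptionStar (⟨0, 0, 1, 1, 0⟩ : WeierstrassCurve ℚ) Dt K P j

/-- **Kriz–Li 2019, §6 Table 1, row `91b1`** (verbatim in the module docstring: `91b1 | d_K = −55 | c₂(E) = 1 | ★ ✓`; Example 6.2): for every imaginary
quadratic field `K` of discriminant `−55`, the optimal curve `91b1` on its (globally minimal) model `[0,1,1,−7,5]` (`y² + y = x³ + x² − 7x + 5`) admits an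
OPTIMAL modular parametrisation datum `Dt` at level `N(E)`, a Heegner datum `H` of discriminant `d_K` and level `N(E)`, an embedding `ι : K → ℂ`, a point
`P ∈ E(K)` mapping to `heegnerPointComplex Dt H`, and `j : K → ℚ₂` with `AssumptionStar E Dt K P j`.  Statement only; TABLE entry; no `_holds` expected.
[cite: KrizLi2019, §6 Table 1 (row 91b1) and Example 6.2 (FMS 7 (2019) e15, chunk p0017 L21; arXiv:1606.03172v3 Congruence.tex ll. 965, 975)] -/
def table1_row91b1 : Prop :=
  ∀ [(⟨0, 1, 1, -7, 5⟩ : WeierstrassCurve ℚ).IsGloballyMinimal]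
    (K : Type) [Field K] [NumberField K], IsImaginaryQuadratic K → NumberField.discr K = -55 →
    ∃ (_ : NeZero ((⟨0, 1, 1, -7, 5⟩ : WeierstrassCurve ℚ).conductorNorm ℤ))
      (Dt : ModularParametrizationData (⟨0, 1, 1, -7, 5⟩ : WeierstrassCurve ℚ) ((⟨0, 1, 1, -7, 5⟩ : WeierstrassCurve ℚ).conductorNorm ℤ))
      (H : HeegnerDatum ((⟨0, 1, 1, -7, 5⟩ : WeierstrassCurve ℚ).conductorNorm ℤ) (NumberField.discr K))
      (ι : K →+* ℂ) (P : ((⟨0, 1, 1, -7, 5⟩ : WeierstrassCurve ℚ).baseChange K).toAffine.Point) (j : K →ₐ[ℚ] ℚ_[2]),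
      Zhai2021.IsOptimalDatum (⟨0, 1, 1, -7, 5⟩ : WeierstrassCurve ℚ) Dt ∧
        WeierstrassCurve.Affine.Point.map ι.toRatAlgHom P = heegnerPointComplex Dt H ∧
          AssumptionStar (⟨0, 1, 1, -7, 5⟩ : WeierstrassCurve ℚ) Dt K P j

end Literature.NumberTheory.EllipticCurves.KrizLi2019

end
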